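import Mathlib
import HarnessLib
import Summits.HubbardSuperconductivity.HubbardSuperconductivity.Theorems.KLProgrammeKLRegimeWickCrossContractionSector
import Summits.HubbardSuperconductivity.HubbardSuperconductivity.Theorems.KLProgrammeKLRegimeWickCrossContractionNorms

/-!
# Route `KLProgramme` — ENGINE child (stmt-HubbardSuperconductivity-19918), `stub_engine_step_values` (E2-v9), E2-WICK-ROADMAP §5 (iv):
# the `k + 1`-line two-vertex term between two SECTOR PREIMAGES, sized by the engine's norms (plain × levels)

Cell gate-hubbard-kl, seat p5 (g4).  The assembled form of the chain …WickCrossContractionIterate (identity) → …WickTwoCopyKernel (block rule) →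
…WickCrossContractionSum (glue with FKT Prop. XII) → …Overlap / …Sector (line data of sectorised normal covariances) → …Norms (vertex sizes = sectorised
norms).  For two polynomials `Ga`, `Gb` of the Hubbard fields, one sector family `F` (at most `ρ₀` overlap partners per multiplier), `k + 1` normal
covariances with symbols `p_0, …, p_k` pulled back to the `F`-sector fields (line `0`: row/column sums `≤ α`; lines `i ≥ 1`: entries `≤ δ_i`), every
colouring `s` of the `m = m₀ + m₁` output legs and every pinned output leg:

* **`sum_norm_kernel_crossContract_sectorPreimage_le`** (pinned leg from `Ga`):
  `Σ_{Z : Z p = z} ‖kernel ((Δ_×(C′_k)∘⋯∘Δ_×(C′_0))((sectorPreimage β F Ga)⁰·(sectorPreimage β F Gb)¹)) m (Z,s)‖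
   ≤ ((k+1+m₀)!(k+1+m₁)!/m!) · α · ∏_i (δ_i·4ρ₀) · (ε_x‖Ga‖_{k+1+m₀, univ}) · (ε_x·Nb)`,
  where `Nb` bounds the LEVEL-`k` norms `‖Gb‖_{k+1+m₁, prescribedTuples univ (none, some∘τ, none…)}` for all sector choices `τ` of the `k` extra lines;
* **`sum_norm_kernel_crossContract_sectorPreimage_le_of_eq_one`** (pinned leg from `Gb`): the roles exchanged — `Ga` at level `k`, `Gb` plain;
* **`…_klAniso_…`** — the two statements on `klAnisoFamily … n` (`ρ₀ = 9`, factor `36` per extra line).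

In the engine: `‖·‖_{univ}` is supplied by `KernelNormsV4`, the level-`k` norm by the private invariant `KernelNormsLevels` (p504160) — the second vertex
must be known ONE LEVEL PER EXTRA LINE higher, which is where the `2^{-n}` of `eremBar`'s `CR`-term comes from (memo E5-GAIN-SCALE-N §2–§3).  Pure
bookkeeping; no definitions, no named facts.  References (locators only): Feldman–Knörrer–Trubowitz, Rev. Math. Phys. 15 (2003) Prop. XII;
Benfatto–Giuliani–Mastropietro, Ann. Henri Poincaré 7 (2006) §2.7–§2.8.
-/

noncomputable section

namespace Summit.HubbardSuperconductivity.HubbardSuperconductivity.Theorems.KLRegimeWick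

set_option linter.dupNamespace false -- summit = problem name (single-conjunct summit), D-0017

open Literature.MathematicalPhysics.QuantumLattice Literature.Probability.LatticeModels GrassmannAlgebra Finset Matrix
open Summit.HubbardSuperconductivity.HubbardSuperconductivity.Theorems.KLRegimeSplit

section Sized

variable {L M N : ℕ} [NeZero L]

/-- **The `k + 1`-line term between two sector preimages, pinned at a free leg of `Ga`**: `Ga` in the plain sectorised norm (degree `k+1+m₀`,
all tuples), `Gb` in the level-`k` norm (degree `k+1+m₁`, the sectors of its `k` extra contracted legs prescribed, bound `Nb` uniform in them). -/
theorem sum_norm_kernel_crossContract_sectorPreimage_le {k m m₀ m₁ : ℕ} {β : ℝ} (hβ : 0 ≤ β) (F : Fin N → FreqMomentum L M → ℂ) {ρ₀ : ℕ}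
    (hρ₀ : ∀ ω : Fin N, ((univ : Finset (Fin N)).filter fun ω' => ∃ q, F ω q * F ω' q ≠ 0).card ≤ ρ₀)
    (sym : Fin (k + 1) → FreqMomentum L M × Fin 2 → ℂ) (Ga Gb : HubbardGrassmann L M) (s : Fin m → Fin 2)
    (hm₀ : (univ.filter fun i => s i = 0).card = m₀) (hm₁ : (univ.filter fun i => s i = 1).card = m₁) (p : Fin m) (hp : s p = 0)
    (z : SpaceTimeIdx L M × SectorLeg N) {α : ℝ}
    (hrow : ∀ X, ∑ Y, ‖((sectorSubMatrix L M β F).transpose * normalCovariance L M (sym 0) * sectorSubMatrix L M β F) X Y‖ ≤ α)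
    (hcol : ∀ Y, ∑ X, ‖((sectorSubMatrix L M β F).transpose * normalCovariance L M (sym 0) * sectorSubMatrix L M β F) X Y‖ ≤ α)
    (δ : Fin k → ℝ) (hδ : ∀ i, 0 ≤ δ i)
    (hent : ∀ (i : Fin k) X Y,
      ‖((sectorSubMatrix L M β F).transpose * normalCovariance L M (sym i.succ) * sectorSubMatrix L M β F) X Y‖ ≤ δ i)
    {Nb : ℝ} (hNb0 : 0 ≤ Nb)
    (hNb : ∀ τ : Fin k → SectorLeg N, hubbardSectorKernelNorm L M β F (prescribedTuples univ
      (Fin.append (Fin.cons none (fun i => some (τ i)) : Fin (k + 1) → Option (SectorLeg N)) (fun _ : Fin m₁ => none))) Gb ≤ Nb) :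
    ∑ Z ∈ univ.filter (fun Z : Fin m → SpaceTimeIdx L M × SectorLeg N => Z p = z),
        ‖kernel ℂ (((List.ofFn fun i => grassmannLaplacian ℂ (crossCov ℂ
            ((sectorSubMatrix L M β F).transpose * normalCovariance L M (sym i) * sectorSubMatrix L M β F))).reverse).prod
          (dblCopy ℂ 0 (sectorPreimage β F Ga) * dblCopy ℂ 1 (sectorPreimage β F Gb))) m (fun i => (Z i, s i))‖ ≤
      (((k + 1 + m₀).factorial * (k + 1 + m₁).factorial : ℝ) / m.factorial) *
        (α * (∏ i, δ i * ((4 * ρ₀ : ℕ) : ℝ)) *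
          (imagTimeWeight β M * hubbardSectorKernelNorm L M β F (univ : Finset (Fin (k + 1 + m₀) → SectorLeg N)) Ga) *
          (imagTimeWeight β M * Nb)) :=
  sum_norm_kernel_crossContract_pullback_le β F hρ₀ sym (sectorPreimage β F Ga) (sectorPreimage β F Gb) s hm₀ hm₁ p hp z hrow hcol δ hδ hent
    (mul_nonneg (imagTimeWeight_nonneg hβ M) hNb0) (fun p₀ => sum_pinned_norm_kernel_sectorPreimage_le hβ F Ga p₀ z)
    fun Y₀ τ => (sum_levels_norm_kernel_sectorPreimage_le hβ F Gb Y₀ τ).trans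
      (mul_le_mul_of_nonneg_left (hNb τ) (imagTimeWeight_nonneg hβ M))

/-- **The same, pinned at a free leg of `Gb`**: `Ga` in the level-`k` norm (bound `Na` uniform in the prescribed sectors), `Gb` plain. -/
theorem sum_norm_kernel_crossContract_sectorPreimage_le_of_eq_one {k m m₀ m₁ : ℕ} {β : ℝ} (hβ : 0 ≤ β)
    (F : Fin N → FreqMomentum L M → ℂ) {ρ₀ : ℕ}
    (hρ₀ : ∀ ω : Fin N, ((univ : Finset (Fin N)).filter fun ω' => ∃ q, F ω q * F ω' q ≠ 0).card ≤ ρ₀)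
    (sym : Fin (k + 1) → FreqMomentum L M × Fin 2 → ℂ) (Ga Gb : HubbardGrassmann L M) (s : Fin m → Fin 2)
    (hm₀ : (univ.filter fun i => s i = 0).card = m₀) (hm₁ : (univ.filter fun i => s i = 1).card = m₁) (p : Fin m) (hp : s p = 1)
    (z : SpaceTimeIdx L M × SectorLeg N) {α : ℝ}
    (hrow : ∀ X, ∑ Y, ‖((sectorSubMatrix L M β F).transpose * normalCovariance L M (sym 0) * sectorSubMatrix L M β F) X Y‖ ≤ α)
    (hcol : ∀ Y, ∑ X, ‖((sectorSubMatrix L M β F).transpose * normalCovariance L M (sym 0) * sectorSubMatrix L M β F) X Y‖ ≤ α)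
    (δ : Fin k → ℝ) (hδ : ∀ i, 0 ≤ δ i)
    (hent : ∀ (i : Fin k) X Y,
      ‖((sectorSubMatrix L M β F).transpose * normalCovariance L M (sym i.succ) * sectorSubMatrix L M β F) X Y‖ ≤ δ i)
    {Na : ℝ} (hNa0 : 0 ≤ Na)
    (hNa : ∀ σ : Fin k → SectorLeg N, hubbardSectorKernelNorm L M β F (prescribedTuples univ
      (Fin.append (Fin.cons none (fun i => some (σ i)) : Fin (k + 1) → Option (SectorLeg N)) (fun _ : Fin m₀ => none))) Ga ≤ Na) :
    ∑ Z ∈ univ.filter (fun Z : Fin m → SpaceTimeIdx L M × SectorLeg N => Z p = z),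
        ‖kernel ℂ (((List.ofFn fun i => grassmannLaplacian ℂ (crossCov ℂ
            ((sectorSubMatrix L M β F).transpose * normalCovariance L M (sym i) * sectorSubMatrix L M β F))).reverse).prod
          (dblCopy ℂ 0 (sectorPreimage β F Ga) * dblCopy ℂ 1 (sectorPreimage β F Gb))) m (fun i => (Z i, s i))‖ ≤
      (((k + 1 + m₀).factorial * (k + 1 + m₁).factorial : ℝ) / m.factorial) *
        (α * (∏ i, δ i * ((4 * ρ₀ : ℕ) : ℝ)) * (imagTimeWeight β M * Na) *
          (imagTimeWeight β M * hubbardSectorKernelNorm L M β F (univ : Finset (Fin (k + 1 + m₁) → SectorLeg N)) Gb)) :=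
  sum_norm_kernel_crossContract_pullback_le_of_eq_one β F hρ₀ sym (sectorPreimage β F Ga) (sectorPreimage β F Gb) s hm₀ hm₁ p hp z hrow
    hcol δ hδ hent (mul_nonneg (imagTimeWeight_nonneg hβ M) hNa0)
    (fun X₀ σ => (sum_levels_norm_kernel_sectorPreimage_le hβ F Ga X₀ σ).trans
      (mul_le_mul_of_nonneg_left (hNa σ) (imagTimeWeight_nonneg hβ M)))
    fun p₁ => sum_pinned_norm_kernel_sectorPreimage_le hβ F Gb p₁ z

end Sized

/-! ## On `klAnisoFamily … n` -/

section Aniso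

open Summit.HubbardSuperconductivity.HubbardSuperconductivity.Theorems.KLProgrammeLegKernels
open Summit.HubbardSuperconductivity.HubbardSuperconductivity.Theorems.PerturbedFermiCurve

variable {L M : ℕ} [NeZero L] {e₀ : ℝ} (he : 0 < e₀) {β : ℝ} (hβ : 0 ≤ β) (μ : ℝ) (K : TrigPolyC4v) (n : ℕ)
include he hβ

/-- **The `k + 1`-line term between two `klAnisoFamily … n`-sector preimages, pinned at a free leg of `Ga`** (factor `36` per extra line). -/
theorem sum_norm_kernel_crossContract_sectorPreimage_klAniso_le {k m m₀ m₁ : ℕ} (sym : Fin (k + 1) → FreqMomentum L M × Fin 2 → ℂ)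
    (Ga Gb : HubbardGrassmann L M) (s : Fin m → Fin 2)
    (hm₀ : (univ.filter fun i => s i = 0).card = m₀) (hm₁ : (univ.filter fun i => s i = 1).card = m₁) (p : Fin m) (hp : s p = 0)
    (z : SpaceTimeIdx L M × SectorLeg (sectorCount n)) {α : ℝ}
    (hrow : ∀ X, ∑ Y, ‖((sectorSubMatrix L M β (klAnisoFamily L M β μ K e₀ n)).transpose * normalCovariance L M (sym 0) *
      sectorSubMatrix L M β (klAnisoFamily L M β μ K e₀ n)) X Y‖ ≤ α)
    (hcol : ∀ Y, ∑ X, ‖((sectorSubMatrix L M β (klAnisoFamily L M β μ K e₀ n)).transpose * normalCovariance L M (sym 0) *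
      sectorSubMatrix L M β (klAnisoFamily L M β μ K e₀ n)) X Y‖ ≤ α)
    (δ : Fin k → ℝ) (hδ : ∀ i, 0 ≤ δ i)
    (hent : ∀ (i : Fin k) X Y, ‖((sectorSubMatrix L M β (klAnisoFamily L M β μ K e₀ n)).transpose * normalCovariance L M (sym i.succ) *
      sectorSubMatrix L M β (klAnisoFamily L M β μ K e₀ n)) X Y‖ ≤ δ i)
    {Nb : ℝ} (hNb0 : 0 ≤ Nb)
    (hNb : ∀ τ : Fin k → SectorLeg (sectorCount n), hubbardSectorKernelNorm L M β (klAnisoFamily L M β μ K e₀ n) (prescribedTuples univ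
      (Fin.append (Fin.cons none (fun i => some (τ i)) : Fin (k + 1) → Option (SectorLeg (sectorCount n))) (fun _ : Fin m₁ => none))) Gb
        ≤ Nb) :
    ∑ Z ∈ univ.filter (fun Z : Fin m → SpaceTimeIdx L M × SectorLeg (sectorCount n) => Z p = z),
        ‖kernel ℂ (((List.ofFn fun i => grassmannLaplacian ℂ (crossCov ℂ
            ((sectorSubMatrix L M β (klAnisoFamily L M β μ K e₀ n)).transpose * normalCovariance L M (sym i) *
              sectorSubMatrix L M β (klAnisoFamily L M β μ K e₀ n)))).reverse).prod
          (dblCopy ℂ 0 (sectorPreimage β (klAnisoFamily L M β μ K e₀ n) Ga) *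
            dblCopy ℂ 1 (sectorPreimage β (klAnisoFamily L M β μ K e₀ n) Gb))) m (fun i => (Z i, s i))‖ ≤
      (((k + 1 + m₀).factorial * (k + 1 + m₁).factorial : ℝ) / m.factorial) *
        (α * (∏ i, δ i * 36) *
          (imagTimeWeight β M * hubbardSectorKernelNorm L M β (klAnisoFamily L M β μ K e₀ n)
            (univ : Finset (Fin (k + 1 + m₀) → SectorLeg (sectorCount n))) Ga) *
          (imagTimeWeight β M * Nb)) := by
  have h := sum_norm_kernel_crossContract_sectorPreimage_le hβ (klAnisoFamily L M β μ K e₀ n)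
    (card_overlap_klAnisoFamily_mul_le_nine he β μ K n) sym Ga Gb s hm₀ hm₁ p hp z hrow hcol δ hδ hent hNb0 hNb
  have e : (∏ i, δ i * ((4 * 9 : ℕ) : ℝ)) = ∏ i, δ i * 36 := prod_congr rfl fun i _ => by push_cast; norm_num
  rwa [e] at h

/-- **The same, pinned at a free leg of `Gb`.** -/
theorem sum_norm_kernel_crossContract_sectorPreimage_klAniso_le_of_eq_one {k m m₀ m₁ : ℕ}
    (sym : Fin (k + 1) → FreqMomentum L M × Fin 2 → ℂ) (Ga Gb : HubbardGrassmann L M) (s : Fin m → Fin 2)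
    (hm₀ : (univ.filter fun i => s i = 0).card = m₀) (hm₁ : (univ.filter fun i => s i = 1).card = m₁) (p : Fin m) (hp : s p = 1)
    (z : SpaceTimeIdx L M × SectorLeg (sectorCount n)) {α : ℝ}
    (hrow : ∀ X, ∑ Y, ‖((sectorSubMatrix L M β (klAnisoFamily L M β μ K e₀ n)).transpose * normalCovariance L M (sym 0) *
      sectorSubMatrix L M β (klAnisoFamily L M β μ K e₀ n)) X Y‖ ≤ α)
    (hcol : ∀ Y, ∑ X, ‖((sectorSubMatrix L M β (klAnisoFamily L M β μ K e₀ n)).transpose * normalCovariance L M (sym 0) *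
      sectorSubMatrix L M β (klAnisoFamily L M β μ K e₀ n)) X Y‖ ≤ α)
    (δ : Fin k → ℝ) (hδ : ∀ i, 0 ≤ δ i)
    (hent : ∀ (i : Fin k) X Y, ‖((sectorSubMatrix L M β (klAnisoFamily L M β μ K e₀ n)).transpose * normalCovariance L M (sym i.succ) *
      sectorSubMatrix L M β (klAnisoFamily L M β μ K e₀ n)) X Y‖ ≤ δ i)
    {Na : ℝ} (hNa0 : 0 ≤ Na)
    (hNa : ∀ σ : Fin k → SectorLeg (sectorCount n), hubbardSectorKernelNorm L M β (klAnisoFamily L M β μ K e₀ n) (prescribedTuples univ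
      (Fin.append (Fin.cons none (fun i => some (σ i)) : Fin (k + 1) → Option (SectorLeg (sectorCount n))) (fun _ : Fin m₀ => none))) Ga
        ≤ Na) :
    ∑ Z ∈ univ.filter (fun Z : Fin m → SpaceTimeIdx L M × SectorLeg (sectorCount n) => Z p = z),
        ‖kernel ℂ (((List.ofFn fun i => grassmannLaplacian ℂ (crossCov ℂ
            ((sectorSubMatrix L M β (klAnisoFamily L M β μ K e₀ n)).transpose * normalCovariance L M (sym i) *
              sectorSubMatrix L M β (klAnisoFamily L M β μ K e₀ n)))).reverse).prod
          (dblCopy ℂ 0 (sectorPreimage β (klAnisoFamily L M β μ K e₀ n) Ga) *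
            dblCopy ℂ 1 (sectorPreimage β (klAnisoFamily L M β μ K e₀ n) Gb))) m (fun i => (Z i, s i))‖ ≤
      (((k + 1 + m₀).factorial * (k + 1 + m₁).factorial : ℝ) / m.factorial) *
        (α * (∏ i, δ i * 36) * (imagTimeWeight β M * Na) *
          (imagTimeWeight β M * hubbardSectorKernelNorm L M β (klAnisoFamily L M β μ K e₀ n)
            (univ : Finset (Fin (k + 1 + m₁) → SectorLeg (sectorCount n))) Gb)) := by
  have h := sum_norm_kernel_crossContract_sectorPreimage_le_of_eq_one hβ (klAnisoFamily L M β μ K e₀ n)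
    (card_overlap_klAnisoFamily_mul_le_nine he β μ K n) sym Ga Gb s hm₀ hm₁ p hp z hrow hcol δ hδ hent hNa0 hNa
  have e : (∏ i, δ i * ((4 * 9 : ℕ) : ℝ)) = ∏ i, δ i * 36 := prod_congr rfl fun i _ => by push_cast; norm_num
  rwa [e] at h

end Aniso

end Summit.HubbardSuperconductivity.HubbardSuperconductivity.Theorems.KLRegimeWick
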